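import Mathlib
import Summits.QuantumFields.BalabanUV.Beta.UnitLatticeOmegaBox
import Summits.QuantumFields.BalabanUV.Beta.UnitLatticeOmegaLocal

/-!
# `Summit.QuantumFields.BalabanUV.Beta.UnitLatticeOmegaBoxLocal` — A3-loc-ω ON A BOX, THE LOCAL INVERSES CONSTRUCTED:
# the box END `termSum_decFamilyΩ_box_one` (p219550) with `L_b := locInv (Knear K near b) □̃_b`
# (`UnitLatticeOmegaLocal.nearLocal_of_pieceMaj`) — hypotheses left: the ONE localised piece bound (rows `hT` + columns
# `hTc`), the ONE global coercivity datum `γ` of `1 + Σ_ω K_ω`, row-locality in cells, the near convention, two lattice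
# profiles and NUMBERS

HONEST FRAMING (page 1 of everything in this cell).  Discharging `FlowStep.BetaPertH` would make Bałaban's ultraviolet
stability UNCONDITIONAL — a constructive-QFT result; NOT the continuum limit, NOT the Clay problem.  This module
discharges nothing of `BetaPertH`; [folklore] bookkeeping, kernel-checked (unit `b2b-balaban-beta-d4-p3`, road P3, gen 5;
skeleton v1.12 §7.9).  WHAT IT IS: the road-P3 «ONE named residual» form of rider (ρ3) with EVERYTHING this lineage can
supply supplied — on the unit lattice of a box `[0, qM]^ν ⊆ ℤ^ν`, for ANY finite piece family with cell budgets, the fully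
decorated ω-expansion is volume-free row data (p219550) AND sums to `(1 + Σ_ω K_ω)⁻¹` at `s ≡ 1` with the local inverses
CONSTRUCTED by accretive Combes–Thomas, GIVEN ONLY: (i) `hT`∕`hTc` — the (T3)-shape bound in the row owner's `pieceMaj`
currency at rate `κ⁺` with weight `κ₁ + κ₂` per cell [= (T3) over NODE O.2; not moved]; (ii) `hRe` — the global
`Re`-coercivity `γ` of `1 + Σ_ω K_ω` [the x-tilt layer (I4): `γ = 1` (PSD); the coarse layer (I3): G-B9-15's lower bound;
not moved]; (iii) row-locality of the pieces in their cells; (iv) the convention «`near b` ⊇ all pieces with `< m₀` cells»;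
(v) two LATTICE PROFILES `L₁`, `L` (sums of `supDist`-weights over the sites — geometry numbers, kept as hypotheses here);
(vi) NUMBERS (`0 < ν`, `0 < M`, `8M ≤ M_d`, rates `0 ≤ κ`, `0 < κ₁`, `0 ≤ κ₂`, `κ′ = κ + κ₁2^ν/(2M) < κ_c < κ⁺` implicitly via
the profiles, the located smallness `κ_cρL₁ < γ′` and `ρ_Ω < 1`).  Nothing of Bałaban's operators is instantiated;
readiness width 0 unchanged; NOT summit progress.
HONEST DEPENDENCY: continuum YM on T⁴ ⇐ BetaPertH ∧ nine spine estimates (0/9 proved); BetaPertH ⇐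
(D1) ∧ (D4) ∧ CAP+tail; G-an2-4 gates asym, D1 and NE2/3/4.

CITATION (locator only; nothing printed is used as a hypothesis).  [II] = T. Bałaban, *Renormalization group approach to
lattice gauge field theories. II*, Commun. Math. Phys. **116**, 1–22 (1988) [Balaban1988RG2Cluster], p. 13 after (2.7)
(«generalized random walk expansions»), (1.11) p. 5; [13] = T. Bałaban, *Propagators for lattice gauge theories in a
background field*, Commun. Math. Phys. **99**, 389–434 (1985) [Balaban1985BackgroundPropagators], p. 422 (G-B9-15).

CONTENTS (0 sorry).  §1 `supDist_comm`, `supDistOn_comm` (symmetry of the sup-distance).  §2 **`termSum_box_of_pieceMaj`**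
(the END).  §3 non-vacuity.
NOT HERE: the lattice profiles as closed-form numbers; the torus twin; any instance on Bałaban's operators.
-/

open scoped BigOperators Matrix
open Finset Matrix Metric Real

namespace Summit.QuantumFields.BalabanUV.Beta.UnitLatticeOmegaBoxLocal

open Summit.QuantumFields.BalabanUV.Beta.UnitLatticeWalkInversion
open Summit.QuantumFields.BalabanUV.Beta.UnitLatticeTubeCount (supDist supDistOn weightHyp_supDistOn gridCellOf)
open Summit.QuantumFields.BalabanUV.Beta.UnitLatticePartition (hPart EPart)
open Summit.QuantumFields.BalabanUV.Beta.UnitLatticeWalkInversionDecay (locInv)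
open Summit.QuantumFields.BalabanUV.Beta.UnitLatticeOmegaTerms
open Summit.QuantumFields.BalabanUV.Beta.UnitLatticeOmegaRowData
open Summit.QuantumFields.BalabanUV.Beta.UnitLatticeOmegaBox
open Summit.QuantumFields.BalabanUV.Beta.UnitLatticeOmegaLocal
open Summit.QuantumFields.BalabanUV.Beta.AnalyticWalkSum216 (termSum)
open Summit.QuantumFields.BalabanUV.Beta.AnalyticWalkSum216RowResolvent (pieceMaj)
open Literature.MathematicalPhysics.QuantumFieldTheory.Balaban1983to89.B13PerturbativeStep (WRS WeightHyp)
open Literature.MathematicalPhysics.QuantumFieldTheory.Balaban1983to89.B5Prop11Lower (nsq)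

noncomputable section

variable {Y : Type*} [Fintype Y] [DecidableEq Y] {Ω : Type*} [Fintype Ω] [DecidableEq Ω] {ν : ℕ}

/-! ## §1 Symmetry of the sup-distance -/

omit [Fintype Y] [DecidableEq Y] in
/-- `supDist z z′ = supDist z′ z`. [folklore] -/
theorem supDist_comm (z z' : Fin ν → ℤ) : supDist z z' = supDist z' z := by
  unfold supDist
  exact Finset.sup_congr rfl fun i _ => by rw [← Int.natAbs_neg, neg_sub]

omit [Fintype Y] [DecidableEq Y] in
/-- `supDistOn e` is symmetric. [folklore] -/
theorem supDistOn_comm (e : Y → (Fin ν → ℤ)) (a b : Y) : supDistOn e a b = supDistOn e b a := by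
  unfold supDistOn
  rw [supDist_comm]

/-! ## §2 The END on the box with constructed local inverses -/

section Box

variable {q : ℕ}

/-- **THE Ω HAND-OFF ON A BOX, LOCAL INVERSES CONSTRUCTED.**  Sites `e : Y → ℤ^ν` inside the box `[0, qM]^ν`; cosine
partition on `M`-cubes; cells of side `M_d ≥ 8M`; pieces `K_ω` row-local in their cells with budgets `cellsOf ω`; near
families containing every piece with fewer than `m₀` cells; local inverses `L_b := locInv (Knear K near b) (EPart M q e) b`
(accretive Combes–Thomas on the compressed near kernel).  INPUTS OF SUBSTANCE: the ONE bound (`hT` rows, `hTc` columns; rate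
`κ⁺`, weight `κ₁ + κ₂`), the ONE datum `hRe` (`γ‖z‖² ≤ Re z^*(1 + Σ_ωK_ω)z`), the profiles `L₁` (first moment at
`κ⁺ − κ_c`) and `L` (zeroth at `κ_c − κ′`, `κ′ = κ + κ₁2^ν/(2M)`), and the numbers `κ_cρL₁ < γ′ := γ − e^{−(κ₁+κ₂)m₀}(ρ + ρ_c)/2`,
`ρ_Ω := C_L·((2·2^ν/(2M/(νπ)))·ρ/(e(κ⁺ − κ′)) + 2^ν e^{−κ₂m₀}ρ) < 1` with `C_L := (γ′ − κ_cρL₁)⁻¹·L`.  THEN at `s ≡ 1` the fully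
decorated ω-expansion SUMS to `(1 + Σ_ω K_ω)⁻¹`. [cite: Balaban1988RG2Cluster, p.13 after (2.7)] -/
theorem termSum_box_of_pieceMaj (hν : 0 < ν) {M Md : ℕ} (hM : 0 < M) (hMd : 8 * M ≤ Md) (e : Y → (Fin ν → ℤ))
    (hbox : ∀ y i, 0 ≤ e y i ∧ e y i ≤ q * M)
    {κ κ₁ κ₂ κp ρ ρc m₀ γ κc L₁ L : ℝ} (hκ : 0 ≤ κ) (hκ₁ : 0 < κ₁) (hκ₂ : 0 ≤ κ₂)
    (K : Ω → Matrix Y Y ℂ) (cellsOf : Ω → Finset (Fin ν → ℤ))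
    (hKcells : ∀ ω k l, K ω k l ≠ 0 → cellAt Md e k ∈ cellsOf ω)
    (near : (Fin ν → Fin (q + 1)) → Finset Ω) (hnear : ∀ b ω, ω ∉ near b → m₀ ≤ (cellsOf ω).card)
    (hκp : κ + κ₁ * ((2 ^ ν : ℕ) / (2 * (M : ℝ))) < κp)
    (hT : ∀ k, ∑ l, (∑ ω, pieceMaj (κ₁ + κ₂) K cellsOf ω k l) * Real.exp (κp * supDistOn e k l) ≤ ρ)
    (hTc : ∀ l, ∑ k, (∑ ω, pieceMaj (κ₁ + κ₂) K cellsOf ω k l) * Real.exp (κp * supDistOn e k l) ≤ ρc)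
    (hRe : ∀ z : Y → ℂ, γ * nsq z ≤ (star z ⬝ᵥ ((1 + Ktot K) *ᵥ z)).re) (hκc : 0 ≤ κc)
    (hL₁ : ∀ i, ∑ j, supDistOn e i j * Real.exp (-((κp - κc) * supDistOn e i j)) ≤ L₁)
    (hL : ∀ i, ∑ j, Real.exp (-((κc - (κ + κ₁ * ((2 ^ ν : ℕ) / (2 * (M : ℝ))))) * supDistOn e i j)) ≤ L) (hL0 : 0 ≤ L)
    (hm : κc * ρ * L₁ < γ - Real.exp (-((κ₁ + κ₂) * m₀)) * (ρ + ρc) / 2)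
    (hρ : (γ - Real.exp (-((κ₁ + κ₂) * m₀)) * (ρ + ρc) / 2 - κc * ρ * L₁)⁻¹ * L
        * (2 * (2 : ℝ) ^ ν / (2 * (M : ℝ) / (ν * π))
          * ((Real.exp 1 * (κp - (κ + κ₁ * ((2 ^ ν : ℕ) / (2 * (M : ℝ))))))⁻¹ * ρ)
          + (2 : ℝ) ^ ν * Real.exp (-(κ₂ * m₀)) * ρ) < 1) (Δ₀ : Fin ν → ℤ) :
    termSum (decFamilyΩ (cellAt Md e) (EPart M q e) (domOf Md e cellsOf) (hPart M q e) K near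
      (fun b => locInv (Knear K near b) (EPart M q e) b) (fun _ => (1 : ℂ)) Δ₀) 1 = (1 + Ktot K)⁻¹ := by
  have hw := weightHyp_supDistOn e hκ
  have hκ'0 : 0 ≤ κ + κ₁ * ((2 ^ ν : ℕ) / (2 * (M : ℝ))) := by positivity
  have hκp0 : 0 ≤ κp := hκ'0.trans hκp.le
  have hw0 : 0 ≤ κ₁ + κ₂ := add_nonneg hκ₁.le hκ₂
  -- the three local-inverse inputs from ONE bound + ONE datum
  obtain ⟨hPL, hloc, hLb⟩ := nearLocal_of_pieceMaj hw (supDistOn_comm e) K cellsOf near (EPart M q e) hw0 hκp0 hnear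
    hT hTc hRe hκc hL₁ hL hL0 hm
  have hC : 0 ≤ (γ - Real.exp (-((κ₁ + κ₂) * m₀)) * (ρ + ρc) / 2 - κc * ρ * L₁)⁻¹ * L :=
    mul_nonneg (inv_nonneg.2 (by linarith)) hL0
  exact termSum_decFamilyΩ_box_one hν hM hMd e hbox hκ hκ₁ hκ₂ hC K cellsOf hKcells near
    (fun b ω k l hω _ _ => hnear b ω hω) (fun b => locInv (Knear K near b) (EPart M q e) b) hPL hloc hLb hκp hT hρ Δ₀

end Box

/-! ## §3 Non-vacuity -/

/-- **NON-VACUITY**: one site at the origin of `ℤ¹` (`q = 0`, `M = 1`, `M_d = 8`), zero pieces with empty cell budgets,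
`near ≡ univ`, `κ = 0`, `κ₁ = 1`, `κ₂ = 0`, `κ⁺ = 2`, `κ_c = 1`, `ρ = ρ_c = 0`, `m₀ = 0`, `γ = 1`, `L₁ = 0`, `L = 1`: the
hypotheses of `termSum_box_of_pieceMaj` are jointly satisfiable and the END reads `termSum … 1 = (1 + 0)⁻¹` with the
CONSTRUCTED local inverse. [folklore] -/
example : termSum (decFamilyΩ (cellAt 8 (fun _ : Fin 1 => (0 : Fin 1 → ℤ))) (EPart 1 0 fun _ : Fin 1 => (0 : Fin 1 → ℤ))
      (domOf 8 (fun _ : Fin 1 => (0 : Fin 1 → ℤ)) (fun _ : Fin 1 => (∅ : Finset (Fin 1 → ℤ))))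
      (hPart 1 0 fun _ : Fin 1 => (0 : Fin 1 → ℤ)) (fun _ : Fin 1 => (0 : Matrix (Fin 1) (Fin 1) ℂ))
      (fun _ => (Finset.univ : Finset (Fin 1)))
      (fun b => locInv (Knear (fun _ : Fin 1 => (0 : Matrix (Fin 1) (Fin 1) ℂ)) (fun _ => Finset.univ) b)
        (EPart 1 0 fun _ : Fin 1 => (0 : Fin 1 → ℤ)) b) (fun _ => (1 : ℂ)) 0) 1
    = (1 + Ktot (fun _ : Fin 1 => (0 : Matrix (Fin 1) (Fin 1) ℂ)))⁻¹ := by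
  have hsd : ∀ i j : Fin 1, supDistOn (fun _ : Fin 1 => (0 : Fin 1 → ℤ)) i j = 0 := fun i j => by
    simp [supDistOn, UnitLatticeTubeCount.supDist_self]
  refine termSum_box_of_pieceMaj (ν := 1) one_pos (M := 1) (Md := 8) one_pos (by norm_num)
    (fun _ : Fin 1 => (0 : Fin 1 → ℤ)) (fun y i => by simp) (κ := 0) (κ₁ := 1) (κ₂ := 0) (κp := 2) (ρ := 0) (ρc := 0)
    (m₀ := 0) (γ := 1) (κc := 1) (L₁ := 0) (L := 1) le_rfl one_pos le_rfl
    (fun _ : Fin 1 => (0 : Matrix (Fin 1) (Fin 1) ℂ)) (fun _ => ∅) (fun ω k l hk => by simp at hk) (fun _ => Finset.univ)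
    (fun b ω hω => absurd (Finset.mem_univ ω) hω) (by norm_num) (fun k => by simp [pieceMaj]) (fun l => by simp [pieceMaj])
    (fun z => ?_) zero_le_one (fun i => by simp [hsd]) (fun i => by simp [hsd]) zero_le_one (by norm_num) (by norm_num) 0
  have hK : Ktot (fun _ : Fin 1 => (0 : Matrix (Fin 1) (Fin 1) ℂ)) = 0 := by simp [Ktot]
  have hform : star z ⬝ᵥ ((1 : Matrix (Fin 1) (Fin 1) ℂ) *ᵥ z) = ((nsq z : ℝ) : ℂ) := by
    rw [← AccretiveCombesThomas.conjForm_zero_rate 1 (fun _ => (0 : ℝ)) z,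
      UnitLatticeWalkInversionDecay.conjForm_one]
  rw [hK, add_zero, hform, Complex.ofReal_re, one_mul]

end

end Summit.QuantumFields.BalabanUV.Beta.UnitLatticeOmegaBoxLocal
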